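import Summits.CriticalPhenomena.PercolationContinuityZ3.Theorems.PercNearOneGluingNoHeavyLowerTailFrontierDecRowsRow44ThreeOneCut
import Summits.CriticalPhenomena.PercolationContinuityZ3.Theorems.PercNearOneGluingNoHeavyLowerTailFrontierDecRowsRow44CrossCut
import Summits.CriticalPhenomena.PercolationContinuityZ3.Theorems.PercNearOneGluingNoHeavyLowerTailGroupThreePointLBRows
import HarnessLib

/-!
# Frontier dec row 44 across a cut vertex: ALL splits of the four terminals (the dihedral symmetry of row 44)

Support file for crux `stmt-CriticalPhenomena-4575` (four-point decreasing `E₃` frontier), seat `prim-l12-p6` gen 15; memo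
`run/shared/lean/prim/prim-l12/FROM-prim-l12-p6-g15-ROW44-CUT-VERTICES.md` §1–3.  No definitions, no named facts, no sorries.

Row 44 `E₃(D[ab|cy], D[a|b], D[c|y])` is invariant under `a ↔ b`, `c ↔ y` and `(a,b) ↔ (c,y)` (a dihedral group of order 8 on the
terminals): `sahiE3_row44_perm_ab/cy/sides` (with `E3GroupSepCert.connEvent_sep_comm`).  Hence the three cut-vertex theorems of the tree —
`sahiE3_row44_nonneg_of_cutVertex` (`{a,b} | {c,y}`, gen 14), `sahiE3_row44_nonneg_of_crossCut` (`{a,c} | {b,y}`) and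
`sahiE3_row44_nonneg_of_threeOneCut` (`{a,b,c} | {y}`) — cover every way a cut vertex can split the terminals: this file records the
remaining placements (`{a,y} | {b,c}`; lone terminal `a`, `b` or `c`).  Consequently a vertex-minimal counterexample to row 44 has no
cut vertex (memo §3).
-/

noncomputable section

namespace Summit.CriticalPhenomena.PercolationContinuityZ3.Theorems.FrontierDecRows

open MeasureTheory CovTransferCert E3GroupSepCert
open Literature.Probability.Percolation Literature.Probability.LatticeModels

variable {n : ℕ}

/-- `D[xz|Y] = D[zx|Y]`. [folklore] -/
theorem connEvent_sep_pair_comm (x z : Fin n) (Y : List (Fin n)) : connEvent (sep [x, z] Y) = connEvent (sep [z, x] Y) := by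
  ext ω
  simp only [mem_connEvent_sep, List.mem_cons, List.mem_nil_iff, or_false, forall_eq_or_imp, forall_eq]
  tauto

/-- Row 44 is invariant under `a ↔ b`. [this work] -/
theorem sahiE3_row44_perm_ab (μ : Measure (BondConfig (Fin n))) (a b c y : Fin n) :
    sahiE3 μ (connEvent (row 44 n (b, a, c, y)).1) (connEvent (row 44 n (b, a, c, y)).2.1) (connEvent (row 44 n (b, a, c, y)).2.2) =
      sahiE3 μ (connEvent (row 44 n (a, b, c, y)).1) (connEvent (row 44 n (a, b, c, y)).2.1)
        (connEvent (row 44 n (a, b, c, y)).2.2) := by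
  have h1 : row 44 n (b, a, c, y) = (sep [b, a] [c, y], sep [b] [a], sep [c] [y]) := rfl
  have h2 : row 44 n (a, b, c, y) = (sep [a, b] [c, y], sep [a] [b], sep [c] [y]) := rfl
  simp only [h1, h2]
  rw [connEvent_sep_pair_comm b a, connEvent_sep_comm [b] [a]]

/-- Row 44 is invariant under `c ↔ y`. [this work] -/
theorem sahiE3_row44_perm_cy (μ : Measure (BondConfig (Fin n))) (a b c y : Fin n) :
    sahiE3 μ (connEvent (row 44 n (a, b, y, c)).1) (connEvent (row 44 n (a, b, y, c)).2.1) (connEvent (row 44 n (a, b, y, c)).2.2) =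
      sahiE3 μ (connEvent (row 44 n (a, b, c, y)).1) (connEvent (row 44 n (a, b, c, y)).2.1)
        (connEvent (row 44 n (a, b, c, y)).2.2) := by
  have h1 : row 44 n (a, b, y, c) = (sep [a, b] [y, c], sep [a] [b], sep [y] [c]) := rfl
  have h2 : row 44 n (a, b, c, y) = (sep [a, b] [c, y], sep [a] [b], sep [c] [y]) := rfl
  simp only [h1, h2]
  rw [connEvent_sep_comm [a, b] [y, c], connEvent_sep_pair_comm y c, connEvent_sep_comm [c, y] [a, b],
    connEvent_sep_comm [y] [c]]

/-- Row 44 is invariant under `(a,b) ↔ (c,y)`. [this work] -/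
theorem sahiE3_row44_perm_sides (μ : Measure (BondConfig (Fin n))) (a b c y : Fin n) :
    sahiE3 μ (connEvent (row 44 n (c, y, a, b)).1) (connEvent (row 44 n (c, y, a, b)).2.1) (connEvent (row 44 n (c, y, a, b)).2.2) =
      sahiE3 μ (connEvent (row 44 n (a, b, c, y)).1) (connEvent (row 44 n (a, b, c, y)).2.1)
        (connEvent (row 44 n (a, b, c, y)).2.2) := by
  have h1 : row 44 n (c, y, a, b) = (sep [c, y] [a, b], sep [c] [y], sep [a] [b]) := rfl
  have h2 : row 44 n (a, b, c, y) = (sep [a, b] [c, y], sep [a] [b], sep [c] [y]) := rfl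
  simp only [h1, h2]
  rw [connEvent_sep_comm [c, y] [a, b], sahiE3_comm₂₃]

/-- **Cross cut `{a,y} | {b,c}`** (from `sahiE3_row44_nonneg_of_crossCut` by `c ↔ y`). [this work] -/
theorem sahiE3_row44_nonneg_of_crossCut' (w : Sym2 (Fin n) → unitInterval) (a b c y h : Fin n) (side : Fin n → Bool)
    (ha : side a = true) (hy : side y = true) (hb : side b = false) (hc : side c = false)
    (hw : ∀ u v : Fin n, u ≠ h → v ≠ h → side u ≠ side v → w s(u, v) = 0) :
    0 ≤ sahiE3 (prodBernoulli w) (connEvent (row 44 n (a, b, c, y)).1) (connEvent (row 44 n (a, b, c, y)).2.1)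
      (connEvent (row 44 n (a, b, c, y)).2.2) := by
  rw [← sahiE3_row44_perm_cy]
  exact sahiE3_row44_nonneg_of_crossCut w a b y c h side ha hy hb hc hw

/-- **Lone terminal `c`** (`{a,b,y} | {c}`; from the `3|1` theorem by `c ↔ y`): row 44 at `(a,b,h,y)` ⟹ row 44 at `(a,b,c,y)`. [this work] -/
theorem sahiE3_row44_nonneg_of_threeOneCut_c (w : Sym2 (Fin n) → unitInterval) (a b c y h : Fin n) (side : Fin n → Bool)
    (ha : side a = true) (hb : side b = true) (hy : side y = true) (hc : side c = false)
    (hw : ∀ u v : Fin n, u ≠ h → v ≠ h → side u ≠ side v → w s(u, v) = 0)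
    (h44 : 0 ≤ sahiE3 (prodBernoulli w) (connEvent (row 44 n (a, b, h, y)).1) (connEvent (row 44 n (a, b, h, y)).2.1)
      (connEvent (row 44 n (a, b, h, y)).2.2)) :
    0 ≤ sahiE3 (prodBernoulli w) (connEvent (row 44 n (a, b, c, y)).1) (connEvent (row 44 n (a, b, c, y)).2.1)
      (connEvent (row 44 n (a, b, c, y)).2.2) := by
  rw [← sahiE3_row44_perm_cy]
  rw [← sahiE3_row44_perm_cy] at h44
  exact sahiE3_row44_nonneg_of_threeOneCut w a b y c h side ha hb hy hc hw h44

/-- **Lone terminal `a`** (`{b,c,y} | {a}`): row 44 at `(h,b,c,y)` ⟹ row 44 at `(a,b,c,y)`. [this work] -/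
theorem sahiE3_row44_nonneg_of_threeOneCut_a (w : Sym2 (Fin n) → unitInterval) (a b c y h : Fin n) (side : Fin n → Bool)
    (hb : side b = true) (hc : side c = true) (hy : side y = true) (ha : side a = false)
    (hw : ∀ u v : Fin n, u ≠ h → v ≠ h → side u ≠ side v → w s(u, v) = 0)
    (h44 : 0 ≤ sahiE3 (prodBernoulli w) (connEvent (row 44 n (h, b, c, y)).1) (connEvent (row 44 n (h, b, c, y)).2.1)
      (connEvent (row 44 n (h, b, c, y)).2.2)) :
    0 ≤ sahiE3 (prodBernoulli w) (connEvent (row 44 n (a, b, c, y)).1) (connEvent (row 44 n (a, b, c, y)).2.1)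
      (connEvent (row 44 n (a, b, c, y)).2.2) := by
  -- (a,b,c,y) ~ (c,y,a,b) ~ (c,y,b,a): the lone terminal `a` sits in the last slot
  rw [← sahiE3_row44_perm_sides, ← sahiE3_row44_perm_cy]
  rw [← sahiE3_row44_perm_sides, ← sahiE3_row44_perm_cy] at h44
  exact sahiE3_row44_nonneg_of_threeOneCut w c y b a h side hc hy hb ha hw h44

/-- **Lone terminal `b`** (`{a,c,y} | {b}`): row 44 at `(a,h,c,y)` ⟹ row 44 at `(a,b,c,y)`. [this work] -/
theorem sahiE3_row44_nonneg_of_threeOneCut_b (w : Sym2 (Fin n) → unitInterval) (a b c y h : Fin n) (side : Fin n → Bool)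
    (ha : side a = true) (hc : side c = true) (hy : side y = true) (hb : side b = false)
    (hw : ∀ u v : Fin n, u ≠ h → v ≠ h → side u ≠ side v → w s(u, v) = 0)
    (h44 : 0 ≤ sahiE3 (prodBernoulli w) (connEvent (row 44 n (a, h, c, y)).1) (connEvent (row 44 n (a, h, c, y)).2.1)
      (connEvent (row 44 n (a, h, c, y)).2.2)) :
    0 ≤ sahiE3 (prodBernoulli w) (connEvent (row 44 n (a, b, c, y)).1) (connEvent (row 44 n (a, b, c, y)).2.1)
      (connEvent (row 44 n (a, b, c, y)).2.2) := by
  -- (a,b,c,y) ~ (c,y,a,b): the lone terminal `b` sits in the last slot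
  rw [← sahiE3_row44_perm_sides]
  rw [← sahiE3_row44_perm_sides] at h44
  exact sahiE3_row44_nonneg_of_threeOneCut w c y a b h side hc hy ha hb hw h44

end Summit.CriticalPhenomena.PercolationContinuityZ3.Theorems.FrontierDecRows
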